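import Mathlib.GroupTheory.OrderOfElement
import Mathlib.Algebra.Group.Subgroup.Finite
import Mathlib.SetTheory.Cardinal.Finite
import HarnessLib

/-!
# Model transport in local Galois cohomology, IV: transporting a cyclic complement along an
# injective map of finite groups of the same order (pure algebra; cell `b2b-bsdres`,
# CLASS-CLOSURE lane, class O10 — x1b GEN 41, class lead; file 104 of the series)

HONEST FRAMING (cell `b2b-bsdres`, run/shared/lean/b2b/bsd-rank1-residual/, verbatim in every
file): the goal of the cell is to DELETE the COMBINATION-SHAPED residual classes of the
Birch–Swinnerton-Dyer formula for ALL analytic-rank `≤ 1` elliptic curves over `ℚ` — "full BSD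
formula for every rank `≤ 1` curve in class `C`" assembled STRICTLY from published theorems — so
that the rank-`≤ 1` remainder becomes exactly the CONSTRUCTION-SHAPED classes, which are TYPED
(missing-input `Prop`s), NOT attempted. This is not "finishing BSD". CLASS-CLOSURE lane: prove
what is provable now; shrink each hard class to its core with data; no claim beyond stated classes;
research routes on CONSTRUCTION-SHAPED X12 / O10; census / instrument output = EVIDENCE / conjecture
items, NEVER a Literature fact; `RESIDUAL-MAP.md` marks change only by signed lines. THIS FILE:
TOOL THEOREMS ONLY (finite abelian groups) — no definition, no named Literature fact, no `sorry`,
axioms standard; nothing is booked; nothing about `BSD(W, p)` of any pair is claimed.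

## What (the algebra of the step `C_{v₀} := Θ⁻¹(Σ_p)` in the re-assembly of the count (C))

`Θ : A →+ B` injective between finite groups of the same order (the transport
`H¹(ℚ_{v₀}, W[p^m]) → H¹(ℚ_p, W[p^m])` of files 101–103: injective, both sides of order `p^{2m}` by
Tate's local Euler characteristic), `K_A ≤ A`, `K_B ≤ B` with `Θ(K_A) = K_B` (the Kummer groups,
file 102), `Σ ≤ B` with `Σ ⊔ K_B = ⊤`, `#Σ = q` and an element of order `q` (B3 at `ℚ_[p]`,
files 91–98). Then the pulled-back line `C = Θ⁻¹(Σ) ≤ A` has **`#C = q`, an element of order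
`q`, and `C ⊔ K_A = ⊤`** (`natCard_comap_eq`, `exists_mem_comap_addOrderOf_eq`,
`comap_sup_eq_top`) — the hypotheses `hCcard`, `hCcyc`, `hCL` of file 100
(`relIndex_strictSignedSelmerLayer_localPreimage_eq_of_minusLine`) at `v₀`.

References: [Kobayashi2003] Thm. 6.2 (p. 11) (the shape `Σ ⊕ 𝓚 = H¹`); folklore group theory.
-/

namespace Summit.BirchSwinnertonDyer.Rank1Residual.Additive.LocalModelTransport

variable {A B : Type*} [AddCommGroup A] [AddCommGroup B] (Θ : A →+ B)

/-- An injective homomorphism between finite groups of the same order is bijective. [folklore] -/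
theorem bijective_of_injective_of_natCard_eq [Finite B] (hinj : Function.Injective Θ)
    (hcard : Nat.card A = Nat.card B) : Function.Bijective Θ := by
  haveI : Finite A := Finite.of_injective Θ hinj
  exact (Nat.bijective_iff_injective_and_card Θ).mpr ⟨hinj, hcard⟩

/-- **`#Θ⁻¹(Σ) = #Σ`** for `Θ` injective between finite groups of the same order. [folklore] -/
theorem natCard_comap_eq [Finite B] (hinj : Function.Injective Θ) (hcard : Nat.card A = Nat.card B)
    (S : AddSubgroup B) : Nat.card (S.comap Θ) = Nat.card S := by
  have hbij := bijective_of_injective_of_natCard_eq Θ hinj hcard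
  have hmap : (S.comap Θ).map Θ = S := AddSubgroup.map_comap_eq_self_of_surjective hbij.2 S
  calc Nat.card (S.comap Θ) = Nat.card ((S.comap Θ).map Θ) :=
        (AddSubgroup.card_map_of_injective hinj).symm
    _ = Nat.card S := by rw [hmap]

/-- **An element of order `q` in `Σ` pulls back to an element of order `q` in `Θ⁻¹(Σ)`** (`Θ`
injective between finite groups of the same order). [folklore] -/
theorem exists_mem_comap_addOrderOf_eq [Finite B] (hinj : Function.Injective Θ)
    (hcard : Nat.card A = Nat.card B) (S : AddSubgroup B) {q : ℕ} {s : B} (hs : s ∈ S)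
    (hord : addOrderOf s = q) : ∃ a ∈ S.comap Θ, addOrderOf a = q := by
  have hbij := bijective_of_injective_of_natCard_eq Θ hinj hcard
  obtain ⟨a, rfl⟩ := hbij.2 s
  exact ⟨a, AddSubgroup.mem_comap.mpr hs, by rw [← hord, addOrderOf_injective Θ hinj a]⟩

/-- **`Θ⁻¹(Σ) ⊔ K_A = ⊤`** when `Σ ⊔ K_B = ⊤` and `Θ(K_A) = K_B` (write `Θ a = σ + Θ k`, `σ ∈ Σ`,
`k ∈ K_A`; then `a − k ∈ Θ⁻¹(Σ)`).
[cite: Kobayashi2003, Thm. 6.2 (p. 11)] -/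
theorem comap_sup_eq_top (S K : AddSubgroup B) (KA : AddSubgroup A) (hK : KA.map Θ = K)
    (hsup : S ⊔ K = ⊤) :
    S.comap Θ ⊔ KA = ⊤ := by
  rw [eq_top_iff]
  intro a _
  have ha : Θ a ∈ S ⊔ K := by rw [hsup]; exact AddSubgroup.mem_top _
  obtain ⟨σ, hσ, k, hk, hσk⟩ := AddSubgroup.mem_sup.mp ha
  rw [← hK] at hk
  obtain ⟨k₀, hk₀, rfl⟩ := AddSubgroup.mem_map.mp hk
  have hmem : a - k₀ ∈ S.comap Θ := by
    rw [AddSubgroup.mem_comap, map_sub, ← hσk, add_sub_cancel_right]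
    exact hσ
  exact AddSubgroup.mem_sup.mpr ⟨a - k₀, hmem, k₀, hk₀, sub_add_cancel a k₀⟩

/-- **The three conclusions together**: `#Θ⁻¹(Σ) = q`, an element of order `q` in `Θ⁻¹(Σ)`, and
`Θ⁻¹(Σ) ⊔ K_A = ⊤` — the hypotheses `hCcard`, `hCcyc`, `hCL` of file 100 for `C = Θ⁻¹(Σ_p)` at `v₀`.
[cite: Kobayashi2003, Thm. 6.2 (p. 11)] -/
theorem comap_line_shape [Finite B] (hinj : Function.Injective Θ) (hcard : Nat.card A = Nat.card B)
    (S K : AddSubgroup B) (KA : AddSubgroup A) (hK : KA.map Θ = K) (hsup : S ⊔ K = ⊤) {q : ℕ}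
    (hS : Nat.card S = q) (hcyc : ∃ s ∈ S, addOrderOf s = q) :
    Nat.card (S.comap Θ) = q ∧ (∃ a ∈ S.comap Θ, addOrderOf a = q) ∧ S.comap Θ ⊔ KA = ⊤ := by
  obtain ⟨s, hs, hord⟩ := hcyc
  exact ⟨(natCard_comap_eq Θ hinj hcard S).trans hS,
    exists_mem_comap_addOrderOf_eq Θ hinj hcard S hs hord,
    comap_sup_eq_top Θ S K KA hK hsup⟩

end Summit.BirchSwinnertonDyer.Rank1Residual.Additive.LocalModelTransport
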